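import Summits.QuantumFields.GaugeBoot.ZdCovariantLinkRP
import HarnessLib

/-!
# Covariant link RP of torus limit points, geometric part: the periodic lift intertwines the
Osterwalder–Seiler substitution and splice (gauge-boot, Class-B brick)

HONEST FRAMING (cell `pub-gaugeboot`, page 1 of every file): the venture produces certified bounds
on lattice expectations at stated coupling, gauge group, dimension and torus size; NOT a mass gap,
NOT a continuum limit, NOT a string tension; NOT Yang–Mills-summit-bearing (barriers
`FixedCouplingUltralocality`, `PerturbativeInvisibility`). Pure lattice geometry; bounds nothing.

Preliminaries for `ClassBLimitCovariantLinkRP.lean` (the covariant link reflection positivity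
`IsCovariantLinkRP` of `ZdCovariantLinkRP.lean` for every torus limit point, every axis):

* near the mirror `x_0 = ½` the torus `(ℤ/L)^d` sees the same layers as `ℤ^d`: for links with
  `-m ≤ x_0 ≤ m` and `m + 1 ≤ L/2` the torus edge below a `ℤ^d` link is a (lower) crossing link of
  Wave 0 iff the link crosses `x_0 = ½`, and never an upper crossing link
  (`isLowerCross_torusEdge_iff`, `isCrossEdge_torusEdge_iff`, `not_isUpperCross_torusEdge`);
* hence the periodic lift intertwines the `ℤ^d` substitution `configCrossTranslate 0` and splice
  `configCrossSplice 0` with Wave 0's `WilsonRP.translate` / `LatticeRP.splice WilsonRP.crossEdges`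
  (even torus) and `WilsonOddRP.translateLow` / `LatticeRP.splice WilsonOddRP.lowerEdges` (odd
  torus) on such links (`torusLift_translate_apply`, `torusLift_splice_apply`,
  `torusLift_translateLow_apply`, `torusLift_spliceLow_apply`) and on cylinder observables
  supported there (`apply_torusLift_translate`, `apply_torusLift_splice`, `apply_torusLift_translateLow`,
  `apply_torusLift_spliceLow`);
* a coefficient observable supported on `linkHalfEdges 0 ∪ linkCrossEdges 0` with `x_0 ≤ m` lifts to
  an observable of Wave 0's `posEdges ∪ crossEdges` (even) / `oPosEdges ∪ lowerEdges ∪ oSharedEdges`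
  (odd) (`dependsOn_toTorusObservable_posCross`, `dependsOn_toTorusObservable_oddPosCross`);
* the axis transposition `(0 i)` conjugates substitution and splice of the mirror `x_i = ½` to
  those of `x_0 = ½` (`configCrossTranslate_eq_conj`, `configCrossSplice_eq_conj`) and carries
  cylinder supports along (`isCylinder_comp_configPerm`, `image_subset_half_union_cross`).

References: K. Osterwalder, E. Seiler, Ann. Phys. 110 (1978) 440, §2; E. Seiler, LNP 159 (1982)
Thm. 2.2. [folklore]
-/

noncomputable section

open Literature.Probability.LatticeModels (Site Torus.proj)
open Literature.MathematicalPhysics.QuantumLattice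
open Literature.MathematicalPhysics.QuantumFieldTheory (GaugeConfig Edge)
open Literature.MathematicalPhysics.QuantumFieldTheory.WilsonRP (IsLowerCross IsUpperCross
  IsCrossEdge translate posEdges crossEdges translate_apply_of_isLowerCross
  translate_apply_of_not_isCrossEdge splice_apply_of_isCrossEdge splice_apply_of_not_isCrossEdge
  mem_posEdges mem_crossEdges)
open Literature.MathematicalPhysics.QuantumFieldTheory.WilsonOddRP (translateLow oPosEdges
  lowerEdges oSharedEdges translateLow_apply_of_isLowerCross translateLow_apply_of_not_isLowerCross
  splice_apply_of_isLowerCross splice_apply_of_not_isLowerCross mem_oPosEdges mem_lowerEdges)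
open Literature.MathematicalPhysics.QuantumFieldTheory.LatticeRP (splice)

namespace Summit.QuantumFields.GaugeBoot

variable {d : ℕ} {G : Type*} [NeZero d]

/-! ## Near the mirror the torus sees the layers of `ℤ^d` -/

section TorusGeometry

/-- The time coordinate of the torus projection of a site with `-L ≤ x_0 < 0`. -/
theorem val_torusProj_zero_of_neg {L : ℕ} [NeZero L] {x : Site d} (h0 : x 0 < 0)
    (hL : -(L : ℤ) ≤ x 0) : (((Torus.proj L x) 0).val : ℤ) = x 0 + L := by
  simp only [Torus.proj]
  rw [ZMod.val_intCast]
  have h1 : (x 0 + L) % (L : ℤ) = x 0 + L := Int.emod_eq_of_lt (by omega) (by omega)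
  rw [← h1, Int.add_emod_right]

/-- **Near the mirror the torus sees the same layers as `ℤ^d`**: for `-m ≤ x_0 ≤ m` and
`m + 1 ≤ L/2`, the time coordinate of the torus projection is `0` iff `x_0 = 0`, and it is
never `L/2` (the even torus' second crossing layer is out of reach). -/
theorem val_torusProj_zero_eq_zero_iff {L : ℕ} [NeZero L] {x : Site d} {m : ℕ}
    (h1 : -(m : ℤ) ≤ x 0) (h2 : x 0 ≤ m) (hmL : m + 1 ≤ L / 2) :
    (((Torus.proj L x) 0).val = 0 ↔ x 0 = 0) ∧ ((Torus.proj L x) 0).val ≠ L / 2 := by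
  have hL2 : (L / 2 : ℕ) ≤ L := Nat.div_le_self L 2
  rcases lt_or_ge (x 0) 0 with hneg | hpos
  · have hv := val_torusProj_zero_of_neg (d := d) (L := L) hneg (by omega)
    refine ⟨⟨fun h => ?_, fun h => ?_⟩, fun h => ?_⟩
    · have : (((Torus.proj L x) 0).val : ℤ) = 0 := by exact_mod_cast h
      omega
    · omega
    · have : (((Torus.proj L x) 0).val : ℤ) = (L / 2 : ℕ) := by exact_mod_cast h
      omega
  · have hv := val_torusProj_zero (d := d) (L := L) (x := x) hpos (by omega)
    refine ⟨⟨fun h => ?_, fun h => ?_⟩, fun h => ?_⟩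
    · have : (((Torus.proj L x) 0).val : ℤ) = 0 := by exact_mod_cast h
      omega
    · have : (((Torus.proj L x) 0).val : ℤ) = 0 := by omega
      exact_mod_cast this
    · have : (((Torus.proj L x) 0).val : ℤ) = (L / 2 : ℕ) := by exact_mod_cast h
      omega

/-- The torus edge below a `ℤ^d` link near the mirror is a lower crossing link iff the link
crosses `x_0 = ½`. -/
theorem isLowerCross_torusEdge_iff {L : ℕ} [NeZero L] {e : ZdEdge d} {m : ℕ}
    (h1 : -(m : ℤ) ≤ e.1 0) (h2 : e.1 0 ≤ m) (hmL : m + 1 ≤ L / 2) :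
    IsLowerCross (torusEdge L e) ↔ e ∈ linkCrossEdges 0 := by
  simp only [IsLowerCross, torusEdge, mem_linkCrossEdges,
    (val_torusProj_zero_eq_zero_iff h1 h2 hmL).1]

/-- Near the mirror no lifted link is an upper crossing link of the even torus. -/
theorem not_isUpperCross_torusEdge {L : ℕ} [NeZero L] {e : ZdEdge d} {m : ℕ}
    (h1 : -(m : ℤ) ≤ e.1 0) (h2 : e.1 0 ≤ m) (hmL : m + 1 ≤ L / 2) :
    ¬ IsUpperCross (torusEdge L e) := fun h =>
  (val_torusProj_zero_eq_zero_iff h1 h2 hmL).2 h.2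

/-- The torus edge below a `ℤ^d` link near the mirror is a crossing link iff the link crosses
`x_0 = ½`. -/
theorem isCrossEdge_torusEdge_iff {L : ℕ} [NeZero L] {e : ZdEdge d} {m : ℕ}
    (h1 : -(m : ℤ) ≤ e.1 0) (h2 : e.1 0 ≤ m) (hmL : m + 1 ≤ L / 2) :
    IsCrossEdge (torusEdge L e) ↔ e ∈ linkCrossEdges 0 := by
  constructor
  · rintro ⟨hk, h | h⟩
    · exact (isLowerCross_torusEdge_iff h1 h2 hmL).1 ⟨hk, h⟩
    · exact absurd h (val_torusProj_zero_eq_zero_iff (x := e.1) h1 h2 hmL).2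
  · intro h
    exact ((isLowerCross_torusEdge_iff h1 h2 hmL).2 h).isCrossEdge

/-! ## The lift intertwines substitution and splice (axis `0`) -/

/-- **The lift intertwines the splices** (even torus, near the mirror). -/
theorem torusLift_splice_apply {L : ℕ} [NeZero L] (V Y : GaugeConfig d L G) {e : ZdEdge d}
    {m : ℕ} (h1 : -(m : ℤ) ≤ e.1 0) (h2 : e.1 0 ≤ m) (hmL : m + 1 ≤ L / 2) :
    torusLift L (splice crossEdges (V, Y)) e =
      configCrossSplice 0 (torusLift L V) (torusLift L Y) e := by
  simp only [torusLift, Function.comp_apply]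
  by_cases he : e ∈ linkCrossEdges (d := d) 0
  · rw [configCrossSplice_apply_of_mem _ _ he,
      splice_apply_of_isCrossEdge V Y ((isCrossEdge_torusEdge_iff h1 h2 hmL).2 he)]
    rfl
  · rw [configCrossSplice_apply_of_not_mem _ _ he,
      splice_apply_of_not_isCrossEdge V Y (mt (isCrossEdge_torusEdge_iff h1 h2 hmL).1 he)]
    rfl

/-- The odd-torus splice under the lift (near the mirror). -/
theorem torusLift_spliceLow_apply {L : ℕ} [NeZero L] (V Y : GaugeConfig d L G) {e : ZdEdge d}
    {m : ℕ} (h1 : -(m : ℤ) ≤ e.1 0) (h2 : e.1 0 ≤ m) (hmL : m + 1 ≤ L / 2) :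
    torusLift L (splice lowerEdges (V, Y)) e =
      configCrossSplice 0 (torusLift L V) (torusLift L Y) e := by
  simp only [torusLift, Function.comp_apply]
  by_cases he : e ∈ linkCrossEdges (d := d) 0
  · rw [configCrossSplice_apply_of_mem _ _ he,
      splice_apply_of_isLowerCross V Y ((isLowerCross_torusEdge_iff h1 h2 hmL).2 he)]
    rfl
  · rw [configCrossSplice_apply_of_not_mem _ _ he,
      splice_apply_of_not_isLowerCross V Y (mt (isLowerCross_torusEdge_iff h1 h2 hmL).1 he)]
    rfl

/-- Cylinder form of `torusLift_splice_apply`. -/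
theorem apply_torusLift_splice {α : Type*} {F : LGConfig d G → α} {S : Finset (ZdEdge d)}
    (hF : IsCylinder F S) {m : ℕ} (hS : ∀ e ∈ S, -(m : ℤ) ≤ e.1 0 ∧ e.1 0 ≤ m) {L : ℕ} [NeZero L]
    (hmL : m + 1 ≤ L / 2) (V Y : GaugeConfig d L G) :
    F (torusLift L (splice crossEdges (V, Y))) =
      F (configCrossSplice 0 (torusLift L V) (torusLift L Y)) :=
  hF fun e he => torusLift_splice_apply V Y (hS e he).1 (hS e he).2 hmL

/-- Cylinder form of `torusLift_spliceLow_apply`. -/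
theorem apply_torusLift_spliceLow {α : Type*} {F : LGConfig d G → α} {S : Finset (ZdEdge d)}
    (hF : IsCylinder F S) {m : ℕ} (hS : ∀ e ∈ S, -(m : ℤ) ≤ e.1 0 ∧ e.1 0 ≤ m) {L : ℕ} [NeZero L]
    (hmL : m + 1 ≤ L / 2) (V Y : GaugeConfig d L G) :
    F (torusLift L (splice lowerEdges (V, Y))) =
      F (configCrossSplice 0 (torusLift L V) (torusLift L Y)) :=
  hF fun e he => torusLift_spliceLow_apply V Y (hS e he).1 (hS e he).2 hmL

section WithGroup

variable [Group G]

/-- **The lift intertwines the substitutions** (even torus, near the mirror):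
`torusLift (translate Y V) = configCrossTranslate 0 (torusLift Y) (torusLift V)` on links with
`|x_0| ≤ m`, `m + 1 ≤ L/2`. -/
theorem torusLift_translate_apply {L : ℕ} [NeZero L] (Y V : GaugeConfig d L G) {e : ZdEdge d}
    {m : ℕ} (h1 : -(m : ℤ) ≤ e.1 0) (h2 : e.1 0 ≤ m) (hmL : m + 1 ≤ L / 2) :
    torusLift L (translate Y V) e =
      configCrossTranslate 0 (torusLift L Y) (torusLift L V) e := by
  haveI : Fact (1 < L) := ⟨by have := Nat.div_le_self L 2; omega⟩
  simp only [torusLift, Function.comp_apply]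
  by_cases he : e ∈ linkCrossEdges (d := d) 0
  · rw [configCrossTranslate_apply_of_mem _ _ he,
      translate_apply_of_isLowerCross Y V ((isLowerCross_torusEdge_iff h1 h2 hmL).2 he)]
    rfl
  · rw [configCrossTranslate_apply_of_not_mem _ _ he,
      translate_apply_of_not_isCrossEdge Y V (mt (isCrossEdge_torusEdge_iff h1 h2 hmL).1 he)]
    rfl

/-- The odd-torus substitution `translateLow` under the lift (near the mirror). -/
theorem torusLift_translateLow_apply {L : ℕ} [NeZero L] (Y V : GaugeConfig d L G) {e : ZdEdge d}
    {m : ℕ} (h1 : -(m : ℤ) ≤ e.1 0) (h2 : e.1 0 ≤ m) (hmL : m + 1 ≤ L / 2) :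
    torusLift L (translateLow Y V) e =
      configCrossTranslate 0 (torusLift L Y) (torusLift L V) e := by
  simp only [torusLift, Function.comp_apply]
  by_cases he : e ∈ linkCrossEdges (d := d) 0
  · rw [configCrossTranslate_apply_of_mem _ _ he,
      translateLow_apply_of_isLowerCross Y V ((isLowerCross_torusEdge_iff h1 h2 hmL).2 he)]
    rfl
  · rw [configCrossTranslate_apply_of_not_mem _ _ he,
      translateLow_apply_of_not_isLowerCross Y V
        (mt (isLowerCross_torusEdge_iff h1 h2 hmL).1 he)]
    rfl

/-- Cylinder form: a cylinder observable supported on `|x_0| ≤ m` reads the lifted even-torus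
substitution as the `ℤ^d` substitution of the lifts. -/
theorem apply_torusLift_translate {α : Type*} {F : LGConfig d G → α} {S : Finset (ZdEdge d)}
    (hF : IsCylinder F S) {m : ℕ} (hS : ∀ e ∈ S, -(m : ℤ) ≤ e.1 0 ∧ e.1 0 ≤ m) {L : ℕ} [NeZero L]
    (hmL : m + 1 ≤ L / 2) (Y V : GaugeConfig d L G) :
    F (torusLift L (translate Y V)) =
      F (configCrossTranslate 0 (torusLift L Y) (torusLift L V)) :=
  hF fun e he => torusLift_translate_apply Y V (hS e he).1 (hS e he).2 hmL

/-- Cylinder form of `torusLift_translateLow_apply`. -/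
theorem apply_torusLift_translateLow {α : Type*} {F : LGConfig d G → α} {S : Finset (ZdEdge d)}
    (hF : IsCylinder F S) {m : ℕ} (hS : ∀ e ∈ S, -(m : ℤ) ≤ e.1 0 ∧ e.1 0 ≤ m) {L : ℕ} [NeZero L]
    (hmL : m + 1 ≤ L / 2) (Y V : GaugeConfig d L G) :
    F (torusLift L (translateLow Y V)) =
      F (configCrossTranslate 0 (torusLift L Y) (torusLift L V)) :=
  hF fun e he => torusLift_translateLow_apply Y V (hS e he).1 (hS e he).2 hmL

end WithGroup

/-! ## Supports of the lifted coefficient observables -/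

/-- A coefficient observable supported on `{1 ≤ x_0 ≤ m} ∪ {crossing links}` has time
coordinates in `[-m, m]`. -/
theorem bounds_of_subset_half_union_cross {T : Finset (ZdEdge d)}
    (hT : (↑T : Set (ZdEdge d)) ⊆ linkHalfEdges 0 ∪ linkCrossEdges 0) {m : ℕ}
    (hTm : ∀ e ∈ T, e.1 0 ≤ m) : ∀ e ∈ T, -(m : ℤ) ≤ e.1 0 ∧ e.1 0 ≤ m := by
  intro e he
  refine ⟨?_, hTm e he⟩
  rcases hT (Finset.mem_coe.2 he) with hh | hc
  · have : (1 : ℤ) ≤ e.1 0 := hh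
    omega
  · rw [hc.2]; omega

/-- **The lifted coefficient observables live on `P ∪ C`** (even torus): a cylinder observable
supported on `linkHalfEdges 0 ∪ linkCrossEdges 0` with `x_0 ≤ m`, `m + 1 ≤ L/2`, lifts to an
observable of the positive and crossing links of `(ℤ/L)^d`. -/
theorem dependsOn_toTorusObservable_posCross {L : ℕ} [NeZero L] {α : Type*}
    {g : LGConfig d G → α} {T : Finset (ZdEdge d)} (hg : IsCylinder g T)
    (hT : (↑T : Set (ZdEdge d)) ⊆ linkHalfEdges 0 ∪ linkCrossEdges 0) {m : ℕ}
    (hTm : ∀ e ∈ T, e.1 0 ≤ m) (hmL : m + 1 ≤ L / 2) :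
    DependsOn (toTorusObservable L g)
      ((posEdges ∪ crossEdges : Finset (Edge d L)) : Set (Edge d L)) := by
  intro U V hUV
  apply hg
  intro e he
  have he' := Finset.mem_coe.1 he
  simp only [torusLift, Function.comp_apply]
  apply hUV
  rw [Finset.coe_union, Set.mem_union, Finset.mem_coe, Finset.mem_coe, mem_posEdges,
    mem_crossEdges]
  rcases hT he with hh | hc
  · left
    have h1 : (1 : ℤ) ≤ e.1 0 := hh
    have hm := hTm e he'
    have hL2 : (L / 2 : ℕ) ≤ L := Nat.div_le_self L 2
    have hv := val_torusProj_zero (d := d) (L := L) (x := e.1) (by omega) (by omega)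
    have hs := val_torusProj_shift_zero (d := d) (L := L) (x := e.1) e.2 (by omega) (by omega)
    refine ⟨?_, ?_, ?_, ?_⟩
    · have : (1 : ℤ) ≤ ((Torus.proj L e.1 0).val : ℤ) := by rw [hv]; exact h1
      exact_mod_cast this
    · have : (((Torus.proj L e.1) 0).val : ℤ) ≤ (L / 2 : ℕ) := by rw [hv]; omega
      exact_mod_cast this
    · have : (1 : ℤ) ≤ ((Literature.MathematicalPhysics.QuantumFieldTheory.Site.shift
          (Torus.proj L e.1) e.2 0).val : ℤ) := by rw [hs]; split_ifs <;> omega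
      exact_mod_cast this
    · have : ((Literature.MathematicalPhysics.QuantumFieldTheory.Site.shift
          (Torus.proj L e.1) e.2 0).val : ℤ) ≤ (L / 2 : ℕ) := by rw [hs]; split_ifs <;> omega
      exact_mod_cast this
  · right
    have hb := bounds_of_subset_half_union_cross hT hTm e he'
    exact ((isLowerCross_torusEdge_iff hb.1 hb.2 hmL).2 hc).isCrossEdge

/-- **The lifted coefficient observables live on `P ∪ C ∪ M`** (odd torus). -/
theorem dependsOn_toTorusObservable_oddPosCross {L : ℕ} [NeZero L] {α : Type*}
    {g : LGConfig d G → α} {T : Finset (ZdEdge d)} (hg : IsCylinder g T)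
    (hT : (↑T : Set (ZdEdge d)) ⊆ linkHalfEdges 0 ∪ linkCrossEdges 0) {m : ℕ}
    (hTm : ∀ e ∈ T, e.1 0 ≤ m) (hmL : m + 1 ≤ L / 2) :
    DependsOn (toTorusObservable L g)
      ((oPosEdges ∪ lowerEdges ∪ oSharedEdges :
        Finset (Edge d L)) : Set (Edge d L)) := by
  intro U V hUV
  apply hg
  intro e he
  have he' := Finset.mem_coe.1 he
  simp only [torusLift, Function.comp_apply]
  apply hUV
  rw [Finset.coe_union, Finset.coe_union, Set.mem_union, Set.mem_union, Finset.mem_coe,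
    Finset.mem_coe, Finset.mem_coe, mem_oPosEdges, mem_lowerEdges]
  rcases hT he with hh | hc
  · left; left
    have h1 : (1 : ℤ) ≤ e.1 0 := hh
    have hm := hTm e he'
    have hL2 : (L / 2 : ℕ) ≤ L := Nat.div_le_self L 2
    have hv := val_torusProj_zero (d := d) (L := L) (x := e.1) (by omega) (by omega)
    refine ⟨?_, ?_⟩
    · have : (1 : ℤ) ≤ ((Torus.proj L e.1 0).val : ℤ) := by rw [hv]; exact h1
      exact_mod_cast this
    · have : (((Torus.proj L e.1) 0).val : ℤ) ≤ (L / 2 : ℕ) := by rw [hv]; omega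
      exact_mod_cast this
  · left; right
    have hb := bounds_of_subset_half_union_cross hT hTm e he'
    exact (isLowerCross_torusEdge_iff hb.1 hb.2 hmL).2 hc

end TorusGeometry

/-! ## Conjugation by the axis transposition `(0 i)` -/

section Transport

/-- **The splice of the mirror `x_i = ½` is conjugate to that of `x_0 = ½` by `(0 i)`.** -/
theorem configCrossSplice_eq_conj (i : Fin d) (U Y : LGConfig d G) :
    configCrossSplice i U Y = configPerm (Equiv.swap 0 i)
      (configCrossSplice 0 (configPerm (Equiv.swap 0 i) U) (configPerm (Equiv.swap 0 i) Y)) := by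
  funext e
  obtain ⟨x, k⟩ := e
  have hx : ((x ∘ ⇑(Equiv.swap 0 i)) ∘ ⇑(Equiv.swap 0 i) : Site d) = x := by
    funext m; simp [Equiv.swap_apply_self]
  simp only [configPerm, configCrossSplice, Equiv.symm_swap, Equiv.swap_apply_self,
    Function.comp_apply, Equiv.swap_apply_left, hx, Equiv.swap_apply_eq_iff]

omit [NeZero d] in
/-- A cylinder observable read through an axis permutation is a cylinder observable on the
permuted links. -/
theorem isCylinder_comp_configPerm {α : Type*} {F : LGConfig d G → α} {T : Finset (ZdEdge d)}
    (hF : IsCylinder F T) (σ : Equiv.Perm (Fin d)) :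
    IsCylinder (F ∘ configPerm σ) (T.image fun e => (e.1 ∘ ⇑σ, σ.symm e.2)) := by
  classical
  intro U V hUV
  apply hF
  intro e he
  exact hUV _ (Finset.mem_coe.2 (Finset.mem_image_of_mem
    (fun e : ZdEdge d => (e.1 ∘ ⇑σ, σ.symm e.2)) (Finset.mem_coe.1 he)))

/-- The links of `linkHalfEdges i ∪ linkCrossEdges i` are carried by `(0 i)` onto those of
`linkHalfEdges 0 ∪ linkCrossEdges 0`. -/
theorem image_subset_half_union_cross (i : Fin d) {T : Finset (ZdEdge d)}
    (hT : (↑T : Set (ZdEdge d)) ⊆ linkHalfEdges i ∪ linkCrossEdges i) :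
    (↑(T.image fun e : ZdEdge d => (e.1 ∘ ⇑(Equiv.swap 0 i), (Equiv.swap 0 i).symm e.2)) :
      Set (ZdEdge d)) ⊆ linkHalfEdges 0 ∪ linkCrossEdges 0 := by
  classical
  intro e' he'
  rw [Finset.coe_image] at he'
  obtain ⟨e, he, rfl⟩ := he'
  rcases hT he with hh | hc
  · left
    have h1 : (1 : ℤ) ≤ e.1 i := hh
    show (1 : ℤ) ≤ (e.1 ∘ ⇑(Equiv.swap 0 i)) 0
    simpa [Equiv.swap_apply_left] using h1
  · right
    obtain ⟨hk, hx⟩ := hc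
    refine ⟨?_, ?_⟩
    · show (Equiv.swap 0 i).symm e.2 = 0
      rw [Equiv.symm_swap, hk, Equiv.swap_apply_right]
    · show (e.1 ∘ ⇑(Equiv.swap 0 i)) 0 = 0
      simpa [Equiv.swap_apply_left] using hx

omit [NeZero d] in
/-- Axis permutations of configurations are continuous. -/
theorem continuous_configPerm [TopologicalSpace G] (σ : Equiv.Perm (Fin d)) :
    Continuous (configPerm (G := G) σ : LGConfig d G → LGConfig d G) :=
  continuous_pi fun _ => continuous_apply _

/-- **The substitution of the mirror `x_i = ½` is conjugate to that of `x_0 = ½` by `(0 i)`.** -/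
theorem configCrossTranslate_eq_conj [Group G] (i : Fin d) (Y U : LGConfig d G) :
    configCrossTranslate i Y U = configPerm (Equiv.swap 0 i)
      (configCrossTranslate 0 (configPerm (Equiv.swap 0 i) Y) (configPerm (Equiv.swap 0 i) U)) := by
  funext e
  obtain ⟨x, k⟩ := e
  have hx : ((x ∘ ⇑(Equiv.swap 0 i)) ∘ ⇑(Equiv.swap 0 i) : Site d) = x := by
    funext m; simp [Equiv.swap_apply_self]
  simp only [configPerm, configCrossTranslate, Equiv.symm_swap, Equiv.swap_apply_self,
    Function.comp_apply, Equiv.swap_apply_left, hx, Equiv.swap_apply_eq_iff]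

end Transport

end Summit.QuantumFields.GaugeBoot
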